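import Summits.CriticalPhenomena.PercolationContinuityZ3.Theorems.PercNearOneGluingNoHeavyLowerTailQ7PsiSetObserverTower
import HarnessLib

/-!
# `NoHeavyLowerTail` (stmt-CriticalPhenomena-4575) — (GΨ₃) for a SET of observers from the two one-cluster halves
# (Kozma–Nitzan Question 9 at `|A| = 3` modulo the set-observer marker dominance lemma)

Support file (`--supports stmt-CriticalPhenomena-4575`), coupling seat `prim-cplus-coupling` (gen 13).  No
definitions, no named facts, no sorries.  Memo A5-COUPLING-gen13.md §3.2 (blueprint step B6; B1 = `…Q7PsiSetObserver.lean`).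

Kozma–Nitzan's Question 9 (arXiv:2401.12397, p. 36) is the pre-FKG inequality (41) for a SET `N` of observers with the
ordinary designation (memo §1); at `|A| = 3` it follows, as in the vertex case (`Q7Psi.q7_of_psi`), from
(GΨ₃-set): `E F(C_z) ≤ E F(C_x), E F(C_y)` ⟹ `∫_{x↔N ∪ y↔N} F(C_z) ≤ ∫_{x↔N ∪ y↔N} F(C_N)`, `C_N = ⋃_{n∈N} C_n`.
The seat's exact census (memo §2: 3,100 instances, n ≤ 9, |N| ≤ 5, 0 failures) certifies (GΨ₃-set) by the explicit
multipliers `λ* = (a + t*(d+e))/μ(x↮z)`, `μ* = (b + (1−t*)(d+e))/μ(y↮z)`; this file proves the bookkeeping half of that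
certificate once and for all:
* `Q7Psi.zhalf_set` — the weak-relay half from the observer half by duality (conditioning on `C_x`, Harris off `C̄_x`);
* `Q7Psi.gpsi_three_set_of_halves` — (GΨ₃-set) from the two observer halves
  `(H_x) λ ∫_{x↮z} G(C_x) ≤ (1−t) ∫_{x↔N, y↮N, z↮N} G(C_x) + t ∫_{x↔N, z↮N} G(C_x)` (all monotone `G`) and `(H_y)`.
What remains for Question 9 at `|A| = 3` is (H_x) ∧ (H_y) at `t = t*`, i.e. the set-observer marker dominance lemma
(memo §3.3; its `z`-free case is `Q7Psi.setObs_cov_ge`).  The pointwise observer weights `(1−t)1_{W1} + t 1_{Wz}` are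
forced: `C_x`-measurable weights cannot work when `x` and `y` hang on different observer vertices (memo §3.1).
[cite: KozmaNitzan2024, §5.1 (pp. 31–32), Question 9 (p. 36)] [cite: VandenbergHaggstromKahn2005, §1 pp. 6–8]
-/

namespace Summit.CriticalPhenomena.PercolationContinuityZ3.Theorems

open MeasureTheory Set Literature.Probability.LatticeModels Literature.Probability.Percolation
open scoped Classical
open KNPreFKG BHK2006 DecisionTree LonePortSum LonePortSumGeneral

noncomputable section

namespace Q7Psi

variable {V : Type*} [Fintype V]

omit [Fintype V] in
/-- Separation events `{v ↮ N}` are decreasing. [folklore] -/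
theorem isLowerSet_notReachSet (v : V) (N : Set V) :
    IsLowerSet {ω : BondConfig V | ∀ n ∈ N, ¬ (openGraph ω).Reachable v n} :=
  fun _ _ hba ha n hn h => ha n hn (h.mono (openGraph_mono hba))

omit [Fintype V] in
/-- Locality of `{v ↮ N}` off the cluster of `x` when `v ∉ C_x`. [cite: VandenbergHaggstromKahn2005, §1 p. 8] -/
theorem notReachSet_sdiff_bar_iff {ω : BondConfig V} {x v : V} (N : Set V) (hxv : ¬ (openGraph ω).Reachable x v) :
    (ω \ {e | ∃ u ∈ e, u = x ∨ ∃ e' ∈ openEdgeCluster ω x, u ∈ e'} ∈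
        {ω : BondConfig V | ∀ n ∈ N, ¬ (openGraph ω).Reachable v n}) ↔
      ω ∈ {ω : BondConfig V | ∀ n ∈ N, ¬ (openGraph ω).Reachable v n} := by
  simp only [mem_setOf_eq]
  exact forall₂_congr fun n _ => not_congr (reachable_sdiff_bar_iff hxv n)

/-- **The weak-relay half for a set of observers, from the observer half by duality.**  With `D = {x ↮ z}`,
`W1 = {x ↔ N} ∩ {y ↮ N} ∩ {z ↮ N}`, `Wz = {x ↔ N} ∩ {z ↮ N}` (`v ↔ N` := `∃ n ∈ N, v ↔ n`): if the observer half
`λ ∫_D G(C_x) ≤ (1−t) ∫_{W1} G(C_x) + t ∫_{Wz} G(C_x)` holds for EVERY monotone `G`, then for every monotone `F ≥ 0`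
`(1−t) ∫_{W1} F(C_z) + t ∫_{Wz} F(C_z) ≤ λ ∫_D F(C_z)`.  Proof: condition on the cluster of `x`
(`setIntegral_offEvent_le`, `setIntegral_cluster_tower`: given `C_x = S` the events `{y ↮ N}`, `{z ↮ N}` are decreasing in
the fresh configuration and `F(C_z)` is increasing, so Harris applies off `S̄`), and apply the hypothesis to the DECREASING
function `S ↦ −E[F(C_z(η ∖ S̄))]`.  (For `N = {o}` this is `Q7Psi.zhalf_of_xhalf`.)
[cite: VandenbergHaggstromKahn2005, §1 pp. 6–8; §2.1 Lemma 2.4 (p. 10)] [cite: KozmaNitzan2024, §5.1 (pp. 31–32)] -/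
theorem zhalf_set (w : Sym2 V → unitInterval) (x y z : V) (N : Set V) (F : Set V → ℝ)
    (hF : ∀ S T : Set V, S ⊆ T → F S ≤ F T) (hF0 : ∀ S, 0 ≤ F S) (t lam : ℝ) (ht0 : 0 ≤ t) (ht1 : t ≤ 1)
    (hHx : ∀ G : Set V → ℝ, (∀ S T : Set V, S ⊆ T → G S ≤ G T) →
      lam * ∫ ω in {ω : BondConfig V | ¬ (openGraph ω).Reachable x z}, G (openCluster ω x) ∂(prodBernoulli w) ≤
        (1 - t) * ∫ ω in {ω : BondConfig V | ∃ n ∈ N, (openGraph ω).Reachable x n} ∩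
            ({ω | ∀ n ∈ N, ¬ (openGraph ω).Reachable y n} ∩ {ω | ∀ n ∈ N, ¬ (openGraph ω).Reachable z n}),
            G (openCluster ω x) ∂(prodBernoulli w) +
          t * ∫ ω in {ω : BondConfig V | ∃ n ∈ N, (openGraph ω).Reachable x n} ∩
            {ω | ∀ n ∈ N, ¬ (openGraph ω).Reachable z n}, G (openCluster ω x) ∂(prodBernoulli w)) :
    (1 - t) * ∫ ω in {ω : BondConfig V | ∃ n ∈ N, (openGraph ω).Reachable x n} ∩
          ({ω | ∀ n ∈ N, ¬ (openGraph ω).Reachable y n} ∩ {ω | ∀ n ∈ N, ¬ (openGraph ω).Reachable z n}),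
          F (openCluster ω z) ∂(prodBernoulli w) +
        t * ∫ ω in {ω : BondConfig V | ∃ n ∈ N, (openGraph ω).Reachable x n} ∩
          {ω | ∀ n ∈ N, ¬ (openGraph ω).Reachable z n}, F (openCluster ω z) ∂(prodBernoulli w) ≤
      lam * ∫ ω in {ω : BondConfig V | ¬ (openGraph ω).Reachable x z}, F (openCluster ω z) ∂(prodBernoulli w) := by
  classical
  set μ := prodBernoulli w with hμ
  -- the conditional mean of `F(C_z)` given `C_x = S`, as a function of the vertex set `S`
  set kV : Set V → ℝ := fun S => ∫ η, F (openCluster (η \ {e | ∃ v ∈ e, v ∈ S}) z) ∂μ with hkV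
  have hkV_anti : ∀ S T : Set V, S ⊆ T → kV T ≤ kV S := by
    intro S T hST
    refine integral_mono (Integrable.of_finite) (Integrable.of_finite) fun η => hF _ _ (openCluster_mono ?_ z)
    exact Set.sdiff_subset_sdiff_right fun e ⟨v, hv, hvS⟩ => ⟨v, hv, hST hvS⟩
  -- the three events as `{P(C_x)} ∩ E`
  set Ox : Set (BondConfig V) := {ω : BondConfig V | ∃ n ∈ N, (openGraph ω).Reachable x n} with hOx
  set Ey : Set (BondConfig V) := {ω | ∀ n ∈ N, ¬ (openGraph ω).Reachable y n} with hEy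
  set Ez : Set (BondConfig V) := {ω | ∀ n ∈ N, ¬ (openGraph ω).Reachable z n} with hEz
  set P1 : Set V → Prop := fun S => (∃ n ∈ N, n ∈ S) ∧ y ∉ S ∧ z ∉ S with hP1
  set Pz : Set V → Prop := fun S => (∃ n ∈ N, n ∈ S) ∧ z ∉ S with hPz
  set P0 : Set V → Prop := fun S => z ∉ S with hP0
  have hW1 : Ox ∩ (Ey ∩ Ez) = {ω : BondConfig V | P1 (openCluster ω x)} ∩ (Ey ∩ Ez) := by
    ext ω
    simp only [hOx, hEy, hEz, hP1, mem_inter_iff, mem_setOf_eq, openCluster]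
    constructor
    · rintro ⟨⟨n, hn, hxn⟩, hy, hz⟩
      exact ⟨⟨⟨n, hn, hxn⟩, fun hxy => hy n hn (hxy.symm.trans hxn), fun hxz => hz n hn (hxz.symm.trans hxn)⟩, hy, hz⟩
    · rintro ⟨⟨hn, _, _⟩, hy, hz⟩
      exact ⟨hn, hy, hz⟩
  have hWz : Ox ∩ Ez = {ω : BondConfig V | Pz (openCluster ω x)} ∩ Ez := by
    ext ω
    simp only [hOx, hEz, hPz, mem_inter_iff, mem_setOf_eq, openCluster]
    constructor
    · rintro ⟨⟨n, hn, hxn⟩, hz⟩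
      exact ⟨⟨⟨n, hn, hxn⟩, fun hxz => hz n hn (hxz.symm.trans hxn)⟩, hz⟩
    · rintro ⟨⟨hn, _⟩, hz⟩
      exact ⟨hn, hz⟩
  have hD : {ω : BondConfig V | ¬ (openGraph ω).Reachable x z} = {ω : BondConfig V | P0 (openCluster ω x)} := by
    ext ω; simp only [hP0, mem_setOf_eq, openCluster]
  -- (A), (B), (C)
  have hA := setIntegral_offEvent_le w x z F hF hF0 P1 (fun ω hP => hP.2.2) (Ey ∩ Ez)
    ((isLowerSet_notReachSet y N).inter (isLowerSet_notReachSet z N))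
    (fun ω hP => by
      rw [mem_inter_iff, mem_inter_iff, notReachSet_sdiff_bar_iff N hP.2.1, notReachSet_sdiff_bar_iff N hP.2.2])
  have hB := setIntegral_offEvent_le w x z F hF hF0 Pz (fun ω hP => hP.2) Ez (isLowerSet_notReachSet z N)
    (fun ω hP => notReachSet_sdiff_bar_iff N hP.2)
  have hC := setIntegral_cluster_tower w x z F P0 (fun ω hP => hP)
  rw [← hW1] at hA
  rw [← hWz] at hB
  rw [← hD] at hC
  -- the hypothesis at the decreasing function `−kV`
  have hG := hHx (fun S => -kV S) (fun S T hST => neg_le_neg (hkV_anti S T hST))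
  simp only [integral_neg, mul_neg] at hG
  change ∫ ω in Ox ∩ (Ey ∩ Ez), F (openCluster ω z) ∂μ ≤ ∫ ω in Ox ∩ (Ey ∩ Ez), kV (openCluster ω x) ∂μ at hA
  change ∫ ω in Ox ∩ Ez, F (openCluster ω z) ∂μ ≤ ∫ ω in Ox ∩ Ez, kV (openCluster ω x) ∂μ at hB
  change ∫ ω in {ω : BondConfig V | ¬ (openGraph ω).Reachable x z}, F (openCluster ω z) ∂μ =
    ∫ ω in {ω : BondConfig V | ¬ (openGraph ω).Reachable x z}, kV (openCluster ω x) ∂μ at hC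
  have h1t : 0 ≤ 1 - t := sub_nonneg.2 ht1
  have e1 := mul_le_mul_of_nonneg_left hA h1t
  have e2 := mul_le_mul_of_nonneg_left hB ht0
  rw [hC]
  linarith


omit [Fintype V] in
/-- A five-term linear combination of weighted sums. [folklore] -/
theorem sum_lin5 {ι : Type*} [Fintype ι] (wt : Set ι → ℝ) (h f₁ f₂ f₃ f₄ f₅ : Set ι → ℝ) (a₁ a₂ a₃ a₄ a₅ : ℝ)
    (hh : ∀ ω, h ω = a₁ * f₁ ω + a₂ * f₂ ω + a₃ * f₃ ω + a₄ * f₄ ω + a₅ * f₅ ω) :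
    ∑ ω, wt ω * h ω = a₁ * ∑ ω, wt ω * f₁ ω + a₂ * ∑ ω, wt ω * f₂ ω + a₃ * ∑ ω, wt ω * f₃ ω +
      a₄ * ∑ ω, wt ω * f₄ ω + a₅ * ∑ ω, wt ω * f₅ ω := by
  have : ∀ ω, wt ω * h ω = a₁ * (wt ω * f₁ ω) + a₂ * (wt ω * f₂ ω) + a₃ * (wt ω * f₃ ω) +
      a₄ * (wt ω * f₄ ω) + a₅ * (wt ω * f₅ ω) := fun ω => by rw [hh]; ring
  simp_rw [this, Finset.sum_add_distrib, ← Finset.mul_sum]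

omit [Fintype V] in
/-- If `v ↔ N` then `C_v ⊆ C_N := ⋃_{n ∈ N} C_n`. [folklore] -/
theorem openCluster_subset_iUnion_of_reach {ω : BondConfig V} {v : V} {N : Set V}
    (h : ∃ n ∈ N, (openGraph ω).Reachable v n) : openCluster ω v ⊆ ⋃ n ∈ N, openCluster ω n := by
  obtain ⟨n, hn, hvn⟩ := h
  intro a ha
  exact mem_iUnion₂.2 ⟨n, hn, hvn.symm.trans ha⟩

/-- **(GΨ₃) for a SET of observers from the two observer halves** (memo A5-COUPLING-gen13 §3.2, B6).  Notation:
`v ↔ N := ∃ n ∈ N, v ↔ n`, `C_N := ⋃_{n∈N} C_n`, `J = {x ↔ N} ∪ {y ↔ N}`, `Dxz = {x ↮ z}`, `Dyz = {y ↮ z}`,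
`W1 = {x↔N} ∩ {y↮N} ∩ {z↮N}`, `Wz = {x↔N} ∩ {z↮N}`, `W2 = {y↔N} ∩ {x↮N} ∩ {z↮N}`, `Wz' = {y↔N} ∩ {z↮N}`.
HYPOTHESES: the two one-cluster halves, for EVERY monotone `G`,
`(H_x)  λ ∫_{Dxz} G(C_x) ≤ (1−t) ∫_{W1} G(C_x) + t ∫_{Wz} G(C_x)`,  `(H_y)  μ ∫_{Dyz} G(C_y) ≤ t ∫_{W2} G(C_y) + (1−t) ∫_{Wz'} G(C_y)`,
with `λ, μ ≥ 0`, `0 ≤ t ≤ 1`; and the (GΨ₃) hypotheses `E F(C_z) ≤ E F(C_x)`, `E F(C_z) ≤ E F(C_y)` for a monotone `F ≥ 0`.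
CONCLUSION: `∫_J F(C_z) ≤ ∫_J F(C_N)`.  Proof: the pointwise observer weights `A_x = (1−t)1_{W1} + t 1_{Wz}`,
`A_y = t 1_{W2} + (1−t) 1_{Wz'}` satisfy `A_x + A_y = 1` on `J ∩ {z ↮ N}` and `F(C_N) ≥ F(C_x)` where `A_x > 0`, so
`∫_J F(C_N) ≥ λ∫_{Dxz}F(C_x) + μ∫_{Dyz}F(C_y) + ∫_{J∩{z↔N}} F(C_N) ≥ λ∫_{Dxz}F(C_z) + μ∫_{Dyz}F(C_z) + ∫_{J∩{z↔N}}F(C_z)`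
(designation on `{x↮z}`, `C_x = C_z` on `{x↔z}`; `C_N ⊇ C_z` on `{z↔N}`), and the weak-relay halves `zhalf_set` bound the
right side below by `∫_J F(C_z)`.  For `N = {o}` this is `Q7Psi.gpsi_three_of_dom ∘ opart_of_halves` with the duality of
`…Q7PsiZDual`; what remains for Question 9 at `|A| = 3` is (H_x), (H_y) — the set-observer marker dominance lemma.
[cite: KozmaNitzan2024, §5.1 (pp. 31–32), Question 9 (p. 36)] [cite: VandenbergHaggstromKahn2005, §1 pp. 6–8] -/
theorem gpsi_three_set_of_halves (w : Sym2 V → unitInterval) (x y z : V) (N : Set V) (F : Set V → ℝ)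
    (hF : ∀ S T : Set V, S ⊆ T → F S ≤ F T) (hF0 : ∀ S, 0 ≤ F S) (t lam mu : ℝ) (ht0 : 0 ≤ t) (ht1 : t ≤ 1)
    (hlam : 0 ≤ lam) (hmu : 0 ≤ mu)
    (hHx : ∀ G : Set V → ℝ, (∀ S T : Set V, S ⊆ T → G S ≤ G T) →
      lam * ∫ ω in {ω : BondConfig V | ¬ (openGraph ω).Reachable x z}, G (openCluster ω x) ∂(prodBernoulli w) ≤
        (1 - t) * ∫ ω in {ω : BondConfig V | ∃ n ∈ N, (openGraph ω).Reachable x n} ∩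
            ({ω | ∀ n ∈ N, ¬ (openGraph ω).Reachable y n} ∩ {ω | ∀ n ∈ N, ¬ (openGraph ω).Reachable z n}),
            G (openCluster ω x) ∂(prodBernoulli w) +
          t * ∫ ω in {ω : BondConfig V | ∃ n ∈ N, (openGraph ω).Reachable x n} ∩
            {ω | ∀ n ∈ N, ¬ (openGraph ω).Reachable z n}, G (openCluster ω x) ∂(prodBernoulli w))
    (hHy : ∀ G : Set V → ℝ, (∀ S T : Set V, S ⊆ T → G S ≤ G T) →
      mu * ∫ ω in {ω : BondConfig V | ¬ (openGraph ω).Reachable y z}, G (openCluster ω y) ∂(prodBernoulli w) ≤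
        t * ∫ ω in {ω : BondConfig V | ∃ n ∈ N, (openGraph ω).Reachable y n} ∩
            ({ω | ∀ n ∈ N, ¬ (openGraph ω).Reachable x n} ∩ {ω | ∀ n ∈ N, ¬ (openGraph ω).Reachable z n}),
            G (openCluster ω y) ∂(prodBernoulli w) +
          (1 - t) * ∫ ω in {ω : BondConfig V | ∃ n ∈ N, (openGraph ω).Reachable y n} ∩
            {ω | ∀ n ∈ N, ¬ (openGraph ω).Reachable z n}, G (openCluster ω y) ∂(prodBernoulli w))
    (hDx : ∫ ω, F (openCluster ω z) ∂(prodBernoulli w) ≤ ∫ ω, F (openCluster ω x) ∂(prodBernoulli w))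
    (hDy : ∫ ω, F (openCluster ω z) ∂(prodBernoulli w) ≤ ∫ ω, F (openCluster ω y) ∂(prodBernoulli w)) :
    ∫ ω in {ω : BondConfig V | ∃ n ∈ N, (openGraph ω).Reachable x n} ∪ {ω | ∃ n ∈ N, (openGraph ω).Reachable y n},
        F (openCluster ω z) ∂(prodBernoulli w) ≤
      ∫ ω in {ω : BondConfig V | ∃ n ∈ N, (openGraph ω).Reachable x n} ∪ {ω | ∃ n ∈ N, (openGraph ω).Reachable y n},
        F (⋃ n ∈ N, openCluster ω n) ∂(prodBernoulli w) := by
  classical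
  set μ := prodBernoulli w with hμ
  set wt : Set (Sym2 V) → ℝ := weight (fun e => (w e : ℝ)) with hwt
  have hwt0 : ∀ ω, 0 ≤ wt ω := fun ω => weight_nonneg (fun e => (w e).2.1) (fun e => (w e).2.2) ω
  -- events
  set Ox : Set (BondConfig V) := {ω : BondConfig V | ∃ n ∈ N, (openGraph ω).Reachable x n} with hOx
  set Oy : Set (BondConfig V) := {ω : BondConfig V | ∃ n ∈ N, (openGraph ω).Reachable y n} with hOy
  set Ex : Set (BondConfig V) := {ω | ∀ n ∈ N, ¬ (openGraph ω).Reachable x n} with hEx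
  set Ey : Set (BondConfig V) := {ω | ∀ n ∈ N, ¬ (openGraph ω).Reachable y n} with hEy
  set Ez : Set (BondConfig V) := {ω | ∀ n ∈ N, ¬ (openGraph ω).Reachable z n} with hEz
  set Dxz : Set (BondConfig V) := {ω : BondConfig V | ¬ (openGraph ω).Reachable x z} with hDxz
  set Dyz : Set (BondConfig V) := {ω : BondConfig V | ¬ (openGraph ω).Reachable y z} with hDyz
  set J : Set (BondConfig V) := Ox ∪ Oy with hJ
  -- functions
  set fN : BondConfig V → ℝ := fun ω => F (⋃ n ∈ N, openCluster ω n) with hfN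
  set fx : BondConfig V → ℝ := fun ω => F (openCluster ω x) with hfx
  set fy : BondConfig V → ℝ := fun ω => F (openCluster ω y) with hfy
  set fz : BondConfig V → ℝ := fun ω => F (openCluster ω z) with hfz
  -- the weak-relay halves
  have hZx := zhalf_set w x y z N F hF hF0 t lam ht0 ht1 hHx
  have hHy' : ∀ G : Set V → ℝ, (∀ S T : Set V, S ⊆ T → G S ≤ G T) →
      mu * ∫ ω in Dyz, G (openCluster ω y) ∂μ ≤
        (1 - (1 - t)) * ∫ ω in Oy ∩ (Ex ∩ Ez), G (openCluster ω y) ∂μ +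
          (1 - t) * ∫ ω in Oy ∩ Ez, G (openCluster ω y) ∂μ := by
    intro G hG
    have h := hHy G hG
    rw [show (1 - (1 - t)) = t by ring]
    exact h
  have hZy := zhalf_set w y x z N F hF hF0 (1 - t) mu (sub_nonneg.2 ht1) (by linarith) hHy'
  rw [show (1 - (1 - t)) = t by ring] at hZy
  -- the observer halves at `G = F`
  have hOxF := hHx F hF
  have hOyF := hHy F hF
  -- everything as finite sums
  change (1 - t) * ∫ ω in Ox ∩ (Ey ∩ Ez), fz ω ∂μ + t * ∫ ω in Ox ∩ Ez, fz ω ∂μ ≤ lam * ∫ ω in Dxz, fz ω ∂μ at hZx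
  change t * ∫ ω in Oy ∩ (Ex ∩ Ez), fz ω ∂μ + (1 - t) * ∫ ω in Oy ∩ Ez, fz ω ∂μ ≤ mu * ∫ ω in Dyz, fz ω ∂μ at hZy
  change lam * ∫ ω in Dxz, fx ω ∂μ ≤ (1 - t) * ∫ ω in Ox ∩ (Ey ∩ Ez), fx ω ∂μ + t * ∫ ω in Ox ∩ Ez, fx ω ∂μ at hOxF
  change mu * ∫ ω in Dyz, fy ω ∂μ ≤ t * ∫ ω in Oy ∩ (Ex ∩ Ez), fy ω ∂μ + (1 - t) * ∫ ω in Oy ∩ Ez, fy ω ∂μ at hOyF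
  change ∫ ω, fz ω ∂μ ≤ ∫ ω, fx ω ∂μ at hDx
  change ∫ ω, fz ω ∂μ ≤ ∫ ω, fy ω ∂μ at hDy
  show ∫ ω in J, fz ω ∂μ ≤ ∫ ω in J, fN ω ∂μ
  rw [setIntegral_eq_sum w, setIntegral_eq_sum w, setIntegral_eq_sum w] at hZx hZy hOxF hOyF
  rw [integral_prodBernoulli_eq_sum, integral_prodBernoulli_eq_sum] at hDx hDy
  rw [setIntegral_eq_sum w, setIntegral_eq_sum w]
  -- pointwise facts
  have hxN : ∀ ω ∈ Ox, fx ω ≤ fN ω := fun ω hω => hF _ _ (openCluster_subset_iUnion_of_reach hω)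
  have hyN : ∀ ω ∈ Oy, fy ω ≤ fN ω := fun ω hω => hF _ _ (openCluster_subset_iUnion_of_reach hω)
  have hzN : ∀ ω, ω ∉ Ez → fz ω ≤ fN ω := by
    intro ω hω
    have h : ∃ n ∈ N, (openGraph ω).Reachable z n := by
      by_contra hcon
      exact hω fun n hn hr => hcon ⟨n, hn, hr⟩
    exact hF _ _ (openCluster_subset_iUnion_of_reach h)
  -- (O): the observer budget, pointwise
  have pO : ∀ ω, wt ω * ((1 - t) * (fx ω * ind (Ox ∩ (Ey ∩ Ez)) ω) + t * (fx ω * ind (Ox ∩ Ez) ω) +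
      t * (fy ω * ind (Oy ∩ (Ex ∩ Ez)) ω) + (1 - t) * (fy ω * ind (Oy ∩ Ez) ω) + 1 * (fN ω * ind (J ∩ Ezᶜ) ω)) ≤
      wt ω * (fN ω * ind J ω) := by
    intro ω
    refine mul_le_mul_of_nonneg_left ?_ (hwt0 ω)
    have h1t : 0 ≤ 1 - t := sub_nonneg.2 ht1
    by_cases hz : ω ∈ Ez
    · have hJc : ω ∉ J ∩ Ezᶜ := fun h => h.2 hz
      rw [ind_of_not_mem hJc]
      by_cases hx : ω ∈ Ox
      · have hJm : ω ∈ J := Or.inl hx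
        rw [ind_of_mem hJm, ind_of_mem (show ω ∈ Ox ∩ Ez from ⟨hx, hz⟩)]
        by_cases hy : ω ∈ Oy
        · have hEy' : ω ∉ Ey := fun h => by obtain ⟨n, hn, hr⟩ := hy; exact h n hn hr
          have hEx' : ω ∉ Ex := fun h => by obtain ⟨n, hn, hr⟩ := hx; exact h n hn hr
          rw [ind_of_not_mem (show ω ∉ Ox ∩ (Ey ∩ Ez) from fun h => hEy' h.2.1),
            ind_of_not_mem (show ω ∉ Oy ∩ (Ex ∩ Ez) from fun h => hEx' h.2.1),
            ind_of_mem (show ω ∈ Oy ∩ Ez from ⟨hy, hz⟩)]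
          have e1 := mul_le_mul_of_nonneg_left (hxN ω hx) ht0
          have e2 := mul_le_mul_of_nonneg_left (hyN ω hy) h1t
          simp only [mul_one, mul_zero, zero_add, add_zero]
          linarith
        · have hEy' : ω ∈ Ey := fun n hn hr => hy ⟨n, hn, hr⟩
          rw [ind_of_mem (show ω ∈ Ox ∩ (Ey ∩ Ez) from ⟨hx, hEy', hz⟩),
            ind_of_not_mem (show ω ∉ Oy ∩ (Ex ∩ Ez) from fun h => hy h.1),
            ind_of_not_mem (show ω ∉ Oy ∩ Ez from fun h => hy h.1)]
          have e1 := hxN ω hx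
          simp only [mul_one, mul_zero, add_zero]
          nlinarith
      · rw [ind_of_not_mem (show ω ∉ Ox ∩ (Ey ∩ Ez) from fun h => hx h.1),
          ind_of_not_mem (show ω ∉ Ox ∩ Ez from fun h => hx h.1)]
        by_cases hy : ω ∈ Oy
        · have hJm : ω ∈ J := Or.inr hy
          have hEx' : ω ∈ Ex := fun n hn hr => hx ⟨n, hn, hr⟩
          rw [ind_of_mem hJm, ind_of_mem (show ω ∈ Oy ∩ (Ex ∩ Ez) from ⟨hy, hEx', hz⟩),
            ind_of_mem (show ω ∈ Oy ∩ Ez from ⟨hy, hz⟩)]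
          have e1 := hyN ω hy
          simp only [mul_one, mul_zero, zero_add, add_zero]
          nlinarith
        · have hJm : ω ∉ J := fun h => h.elim hx hy
          rw [ind_of_not_mem hJm, ind_of_not_mem (show ω ∉ Oy ∩ (Ex ∩ Ez) from fun h => hy h.1),
            ind_of_not_mem (show ω ∉ Oy ∩ Ez from fun h => hy h.1)]
          simp
    · rw [ind_of_not_mem (show ω ∉ Ox ∩ (Ey ∩ Ez) from fun h => hz h.2.2),
        ind_of_not_mem (show ω ∉ Ox ∩ Ez from fun h => hz h.2),
        ind_of_not_mem (show ω ∉ Oy ∩ (Ex ∩ Ez) from fun h => hz h.2.2),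
        ind_of_not_mem (show ω ∉ Oy ∩ Ez from fun h => hz h.2)]
      by_cases hJm : ω ∈ J
      · rw [ind_of_mem hJm, ind_of_mem (show ω ∈ J ∩ Ezᶜ from ⟨hJm, hz⟩)]
        simp
      · rw [ind_of_not_mem hJm, ind_of_not_mem (show ω ∉ J ∩ Ezᶜ from fun h => hJm h.1)]
        simp
  -- (Z): the weak-relay mass, pointwise identity, and `C_z ⊆ C_N` on `{z ↔ N}`
  have pZ : ∀ ω, fz ω * ind J ω = (1 - t) * (fz ω * ind (Ox ∩ (Ey ∩ Ez)) ω) + t * (fz ω * ind (Ox ∩ Ez) ω) +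
      t * (fz ω * ind (Oy ∩ (Ex ∩ Ez)) ω) + (1 - t) * (fz ω * ind (Oy ∩ Ez) ω) + 1 * (fz ω * ind (J ∩ Ezᶜ) ω) := by
    intro ω
    by_cases hz : ω ∈ Ez
    · have hJc : ω ∉ J ∩ Ezᶜ := fun h => h.2 hz
      rw [ind_of_not_mem hJc]
      by_cases hx : ω ∈ Ox
      · rw [ind_of_mem (show ω ∈ J from Or.inl hx), ind_of_mem (show ω ∈ Ox ∩ Ez from ⟨hx, hz⟩)]
        by_cases hy : ω ∈ Oy
        · have hEy' : ω ∉ Ey := fun h => by obtain ⟨n, hn, hr⟩ := hy; exact h n hn hr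
          have hEx' : ω ∉ Ex := fun h => by obtain ⟨n, hn, hr⟩ := hx; exact h n hn hr
          rw [ind_of_not_mem (show ω ∉ Ox ∩ (Ey ∩ Ez) from fun h => hEy' h.2.1),
            ind_of_not_mem (show ω ∉ Oy ∩ (Ex ∩ Ez) from fun h => hEx' h.2.1),
            ind_of_mem (show ω ∈ Oy ∩ Ez from ⟨hy, hz⟩)]
          ring
        · have hEy' : ω ∈ Ey := fun n hn hr => hy ⟨n, hn, hr⟩
          rw [ind_of_mem (show ω ∈ Ox ∩ (Ey ∩ Ez) from ⟨hx, hEy', hz⟩),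
            ind_of_not_mem (show ω ∉ Oy ∩ (Ex ∩ Ez) from fun h => hy h.1),
            ind_of_not_mem (show ω ∉ Oy ∩ Ez from fun h => hy h.1)]
          ring
      · rw [ind_of_not_mem (show ω ∉ Ox ∩ (Ey ∩ Ez) from fun h => hx h.1),
          ind_of_not_mem (show ω ∉ Ox ∩ Ez from fun h => hx h.1)]
        by_cases hy : ω ∈ Oy
        · have hEx' : ω ∈ Ex := fun n hn hr => hx ⟨n, hn, hr⟩
          rw [ind_of_mem (show ω ∈ J from Or.inr hy), ind_of_mem (show ω ∈ Oy ∩ (Ex ∩ Ez) from ⟨hy, hEx', hz⟩),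
            ind_of_mem (show ω ∈ Oy ∩ Ez from ⟨hy, hz⟩)]
          ring
        · rw [ind_of_not_mem (show ω ∉ J from fun h => h.elim hx hy),
            ind_of_not_mem (show ω ∉ Oy ∩ (Ex ∩ Ez) from fun h => hy h.1),
            ind_of_not_mem (show ω ∉ Oy ∩ Ez from fun h => hy h.1)]
          ring
    · rw [ind_of_not_mem (show ω ∉ Ox ∩ (Ey ∩ Ez) from fun h => hz h.2.2),
        ind_of_not_mem (show ω ∉ Ox ∩ Ez from fun h => hz h.2),
        ind_of_not_mem (show ω ∉ Oy ∩ (Ex ∩ Ez) from fun h => hz h.2.2),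
        ind_of_not_mem (show ω ∉ Oy ∩ Ez from fun h => hz h.2)]
      by_cases hJm : ω ∈ J
      · rw [ind_of_mem hJm, ind_of_mem (show ω ∈ J ∩ Ezᶜ from ⟨hJm, hz⟩)]
        ring
      · rw [ind_of_not_mem hJm, ind_of_not_mem (show ω ∉ J ∩ Ezᶜ from fun h => hJm h.1)]
        ring
  have pNz : ∀ ω, wt ω * (fz ω * ind (J ∩ Ezᶜ) ω) ≤ wt ω * (fN ω * ind (J ∩ Ezᶜ) ω) := by
    intro ω
    refine mul_le_mul_of_nonneg_left ?_ (hwt0 ω)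
    by_cases h : ω ∈ J ∩ Ezᶜ
    · rw [ind_of_mem h, mul_one, mul_one]; exact hzN ω h.2
    · rw [ind_of_not_mem h, mul_zero, mul_zero]
  -- (D): designation transferred to `{x ↮ z}` (resp. `{y ↮ z}`): off these events the clusters coincide
  have pDx : ∀ ω, wt ω * fx ω - wt ω * (fx ω * ind Dxz ω) = wt ω * fz ω - wt ω * (fz ω * ind Dxz ω) := by
    intro ω
    by_cases h : ω ∈ Dxz
    · rw [ind_of_mem h, mul_one, mul_one, sub_self, sub_self]
    · have hxz : (openGraph ω).Reachable x z := not_not.1 h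
      rw [ind_of_not_mem h]
      simp only [mul_zero, sub_zero, hfx, hfz, openCluster_eq_of_reachable hxz]
  have pDy : ∀ ω, wt ω * fy ω - wt ω * (fy ω * ind Dyz ω) = wt ω * fz ω - wt ω * (fz ω * ind Dyz ω) := by
    intro ω
    by_cases h : ω ∈ Dyz
    · rw [ind_of_mem h, mul_one, mul_one, sub_self, sub_self]
    · have hyz : (openGraph ω).Reachable y z := not_not.1 h
      rw [ind_of_not_mem h]
      simp only [mul_zero, sub_zero, hfy, hfz, openCluster_eq_of_reachable hyz]
  -- sum the pointwise facts
  have sO := Finset.sum_le_sum fun ω (_ : ω ∈ Finset.univ) => pO ω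
  have sNz := Finset.sum_le_sum fun ω (_ : ω ∈ Finset.univ) => pNz ω
  have sDx : ∑ ω, wt ω * fx ω - ∑ ω, wt ω * (fx ω * ind Dxz ω) =
      ∑ ω, wt ω * fz ω - ∑ ω, wt ω * (fz ω * ind Dxz ω) := by
    rw [← Finset.sum_sub_distrib, ← Finset.sum_sub_distrib]
    exact Finset.sum_congr rfl fun ω _ => pDx ω
  have sDy : ∑ ω, wt ω * fy ω - ∑ ω, wt ω * (fy ω * ind Dyz ω) =
      ∑ ω, wt ω * fz ω - ∑ ω, wt ω * (fz ω * ind Dyz ω) := by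
    rw [← Finset.sum_sub_distrib, ← Finset.sum_sub_distrib]
    exact Finset.sum_congr rfl fun ω _ => pDy ω
  rw [sum_lin5 wt _ (fun ω => fx ω * ind (Ox ∩ (Ey ∩ Ez)) ω) (fun ω => fx ω * ind (Ox ∩ Ez) ω)
    (fun ω => fy ω * ind (Oy ∩ (Ex ∩ Ez)) ω) (fun ω => fy ω * ind (Oy ∩ Ez) ω) (fun ω => fN ω * ind (J ∩ Ezᶜ) ω)
    (1 - t) t t (1 - t) 1 (fun ω => rfl)] at sO
  have sZ := sum_lin5 wt (fun ω => fz ω * ind J ω) (fun ω => fz ω * ind (Ox ∩ (Ey ∩ Ez)) ω)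
    (fun ω => fz ω * ind (Ox ∩ Ez) ω) (fun ω => fz ω * ind (Oy ∩ (Ex ∩ Ez)) ω) (fun ω => fz ω * ind (Oy ∩ Ez) ω)
    (fun ω => fz ω * ind (J ∩ Ezᶜ) ω) (1 - t) t t (1 - t) 1 pZ
  -- the two products `λ · (…)`, `μ · (…)`
  have pl : lam * ∑ ω, wt ω * (fz ω * ind Dxz ω) ≤ lam * ∑ ω, wt ω * (fx ω * ind Dxz ω) :=
    mul_le_mul_of_nonneg_left (by linarith) hlam
  have pm : mu * ∑ ω, wt ω * (fz ω * ind Dyz ω) ≤ mu * ∑ ω, wt ω * (fy ω * ind Dyz ω) :=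
    mul_le_mul_of_nonneg_left (by linarith) hmu
  linarith

end Q7Psi

end

end Summit.CriticalPhenomena.PercolationContinuityZ3.Theorems
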